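import Summits.CriticalPhenomena.PercolationContinuityZ3.Theorems.SahiLiebSahiContinuum

/-!
# The continuous case does not depend on Lebesgue measure: every PRODUCT probability measure on `Q_d`
# (atoms and singular marginals allowed), and every monotone image of it

Companion of `SahiLiebSahiContinuum.lean` (cell `prim-sahi`, typer, generation 6; `--supports
stmt-CriticalPhenomena-4575`).

Lieb–Sahi's continuous case `LiebSahiContinuum d n` (`E_n ≥ 0` for positive monotone functions on `Q_d = [0,1]^d`
with LEBESGUE measure) already controls every probability measure on `Q_d` which is the image of Lebesgue measure
under a monotone measurable map — in particular every product probability measure `μ_1 ⊗ ⋯ ⊗ μ_d` (arbitrary Borel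
probability measures `μ_j` on `[0,1]`, with atoms, singular parts, …), by the **quantile transform**: the monotone
map `u ↦ inf {t : u ≤ μ_j([0,t])}` pushes Lebesgue measure of `[0,1]` to `μ_j`
(`UnitIntervalQuantile.measurePreserving_quantile`; Mathlib has no quantile transform, so it is built here on
`unitInterval` from the distribution function and `MeasureTheory.Measure.ext_of_Iic`).  Proved:

* `msahiE_map_nonneg_of_liebSahiContinuum` — `LiebSahiContinuum d n ⇒ E_n ≥ 0` under `G_* λ` for every monotone
  measurable `G : Q_d → Ω` into a measurable preorder and every nonnegative monotone MEASURABLE family on `Ω`;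
* `msahiE_pi_nonneg_of_liebSahiContinuum` (`…_antitone`) — in particular under every product probability
  measure `Measure.pi μ` on `Q_d`;
* `liebSahiContinuum_iff_pi` — so the continuous case for Lebesgue measure is EQUIVALENT to the continuous case for
  all product probability measures on `Q_d` (measurable families; for Lebesgue measure measurability is automatic,
  `LebesgueCube.mSahiPositive_volume_of_measurable`);
* UNCONDITIONALLY (`d ≤ 2` being theorems): **every product probability measure `μ_1 ⊗ μ_2` on the unit square is
  Sahi-positive of every order for measurable families** — `msahiE_prod_nonneg_of_monotone`,
  `msahiE_prod_nonneg_of_antitone` (on `I × I`), `msahiE_pi_nonneg_of_le_two` (on `Fin d → I`, `d ≤ 2`).  This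
  extends Lieb–Sahi's Theorem 3.7 (Lebesgue) and the tree's `SahiTwoDimDensity.mSahiPositive_withDensity'`
  (absolutely continuous FKG measures) to product measures with atoms / singular marginals.

Nothing here asserts `LiebSahiContinuum d n` for `d ≥ 3`.
-/

noncomputable section

namespace Summit.CriticalPhenomena.PercolationContinuityZ3.Theorems

open MeasureTheory Set Filter Topology Literature.Combinatorics.Sahi2008
open scoped unitInterval BigOperators

/-! ### The quantile transform on `[0,1]` -/

namespace UnitIntervalQuantile

variable (μ : Measure I) [IsProbabilityMeasure μ]

/-- The distribution function of `μ`, extended to `ℝ`: `F(t) = μ{y ∈ [0,1] : y ≤ t}`. [folklore] -/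
def cdf (t : ℝ) : ℝ := μ.real {y : I | (y : ℝ) ≤ t}

/-- `F` is monotone. [folklore] -/
theorem cdf_mono : Monotone (cdf μ) := fun _ _ hst =>
  measureReal_mono (fun _ hy => le_trans hy hst) (measure_ne_top _ _)

omit [IsProbabilityMeasure μ] in
/-- `0 ≤ F`. [folklore] -/
theorem cdf_nonneg (t : ℝ) : 0 ≤ cdf μ t := measureReal_nonneg

/-- `F ≤ 1`. [folklore] -/
theorem cdf_le_one (t : ℝ) : cdf μ t ≤ 1 :=
  (measureReal_mono (Set.subset_univ _) (measure_ne_top _ _)).trans (by rw [probReal_univ])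

/-- `F(1) = 1`. [folklore] -/
theorem cdf_one : cdf μ 1 = 1 := by
  have h : {y : I | (y : ℝ) ≤ 1} = Set.univ := Set.eq_univ_of_forall fun y => y.2.2
  rw [cdf, h, probReal_univ]

omit [IsProbabilityMeasure μ] in
/-- On `[0,1]`, `F(x) = μ(Iic x)`. [folklore] -/
theorem cdf_coe (x : I) : cdf μ x = μ.real (Set.Iic x) := rfl

/-- `F` is right-continuous along `t + 1/(k+1)` (continuity of the measure from above). [folklore] -/
theorem tendsto_cdf_add_inv (t : ℝ) :
    Tendsto (fun k : ℕ => cdf μ (t + 1 / ((k : ℝ) + 1))) atTop (𝓝 (cdf μ t)) := by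
  set s : ℕ → Set I := fun k => {y : I | (y : ℝ) ≤ t + 1 / ((k : ℝ) + 1)} with hs
  have hsm : ∀ k, NullMeasurableSet (s k) μ := fun k =>
    (measurableSet_le measurable_subtype_coe measurable_const).nullMeasurableSet
  have hm : Antitone s := by
    intro k l hkl y hy
    have hy' : (y : ℝ) ≤ t + 1 / ((l : ℝ) + 1) := hy
    have hk : (0 : ℝ) < (k : ℝ) + 1 := by positivity
    have hkl' : (1 : ℝ) / ((l : ℝ) + 1) ≤ 1 / ((k : ℝ) + 1) :=
      one_div_le_one_div_of_le hk (by exact_mod_cast Nat.add_le_add_right hkl 1)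
    show (y : ℝ) ≤ t + 1 / ((k : ℝ) + 1)
    linarith
  have hlim := tendsto_measure_iInter_atTop hsm hm ⟨0, measure_ne_top _ _⟩
  have hinter : (⋂ k, s k) = {y : I | (y : ℝ) ≤ t} := by
    ext y
    simp only [Set.mem_iInter, Set.mem_setOf_eq, hs]
    constructor
    · intro h
      have hlim0 : Tendsto (fun k : ℕ => t + 1 / ((k : ℝ) + 1)) atTop (𝓝 t) := by
        have h0 := (tendsto_const_div_atTop_nhds_zero_nat (1 : ℝ)).comp (tendsto_add_atTop_nat 1)
        have h0' : Tendsto (fun k : ℕ => (1 : ℝ) / ((k : ℝ) + 1)) atTop (𝓝 0) := by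
          refine h0.congr fun k => ?_
          simp only [Function.comp_apply, Nat.cast_add, Nat.cast_one]
        simpa using (tendsto_const_nhds (x := t)).add h0'
      exact ge_of_tendsto' hlim0 fun k => h k
    · intro h k
      have : (0 : ℝ) ≤ 1 / ((k : ℝ) + 1) := by positivity
      linarith
  rw [hinter] at hlim
  have hreal := (ENNReal.tendsto_toReal (measure_ne_top μ {y : I | (y : ℝ) ≤ t})).comp hlim
  refine hreal.congr fun k => ?_
  simp only [Function.comp_apply, cdf, measureReal_def, hs]

/-- The set whose infimum is the quantile: `{t ≥ 0 : u ≤ F(t)}`. [folklore] -/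
def qSet (u : I) : Set ℝ := {t : ℝ | 0 ≤ t ∧ (u : ℝ) ≤ cdf μ t}

/-- `1` lies in the quantile set. [folklore] -/
theorem one_mem_qSet (u : I) : (1 : ℝ) ∈ qSet μ u :=
  ⟨zero_le_one, by rw [cdf_one]; exact u.2.2⟩

/-- The quantile set is nonempty. [folklore] -/
theorem qSet_nonempty (u : I) : (qSet μ u).Nonempty := ⟨1, one_mem_qSet μ u⟩

omit [IsProbabilityMeasure μ] in
/-- The quantile set is bounded below by `0`. [folklore] -/
theorem bddBelow_qSet (u : I) : BddBelow (qSet μ u) := ⟨0, fun _ ht => ht.1⟩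

/-- **The quantile transform** `G(u) = inf {t ≥ 0 : u ≤ μ([0,t])} ∈ [0,1]`. [folklore] -/
def quantile (u : I) : I :=
  ⟨sInf (qSet μ u),
    ⟨le_csInf (qSet_nonempty μ u) fun _ ht => ht.1, csInf_le (bddBelow_qSet μ u) (one_mem_qSet μ u)⟩⟩

/-- The value of the quantile transform. [folklore] -/
theorem coe_quantile (u : I) : (quantile μ u : ℝ) = sInf (qSet μ u) := rfl

/-- **The quantile lies in its set**: `u ≤ F(G(u))` (right-continuity of `F`). [folklore] -/
theorem le_cdf_quantile (u : I) : (u : ℝ) ≤ cdf μ (quantile μ u) := by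
  set q : ℝ := sInf (qSet μ u) with hq
  have hstep : ∀ k : ℕ, (u : ℝ) ≤ cdf μ (q + 1 / ((k : ℝ) + 1)) := by
    intro k
    have hlt : q < q + 1 / ((k : ℝ) + 1) := by
      have : (0 : ℝ) < 1 / ((k : ℝ) + 1) := by positivity
      linarith
    obtain ⟨a, ha, hak⟩ := exists_lt_of_csInf_lt (qSet_nonempty μ u) hlt
    exact ha.2.trans (cdf_mono μ hak.le)
  exact ge_of_tendsto' (tendsto_cdf_add_inv μ q) hstep

/-- **Galois property**: `G(u) ≤ x ↔ u ≤ F(x)` for `x ∈ [0,1]`. [folklore] -/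
theorem quantile_le_iff (u x : I) : quantile μ u ≤ x ↔ (u : ℝ) ≤ cdf μ x := by
  constructor
  · intro h
    exact (le_cdf_quantile μ u).trans (cdf_mono μ (Subtype.coe_le_coe.2 h))
  · intro h
    exact Subtype.coe_le_coe.1 (csInf_le (bddBelow_qSet μ u) ⟨x.2.1, h⟩)

/-- The quantile transform is monotone. [folklore] -/
theorem quantile_mono : Monotone (quantile μ) := by
  intro u v huv
  refine Subtype.coe_le_coe.1 ?_
  rw [coe_quantile, coe_quantile]
  exact csInf_le_csInf (bddBelow_qSet μ u) (qSet_nonempty μ v) fun t ht =>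
    ⟨ht.1, (Subtype.coe_le_coe.2 huv).trans ht.2⟩

/-- The quantile transform is measurable (it is monotone). [folklore] -/
theorem measurable_quantile : Measurable (quantile μ) := (quantile_mono μ).measurable

/-- **The quantile transform pushes Lebesgue measure of `[0,1]` to `μ`** (the two measures agree on every
`Iic x`, `λ{u : G(u) ≤ x} = λ{u : u ≤ F(x)} = F(x) = μ(Iic x)`). [folklore] -/
theorem map_quantile_volume : (volume : Measure I).map (quantile μ) = μ := by
  refine (Measure.ext_of_Iic μ _ fun x => ?_).symm
  rw [Measure.map_apply (measurable_quantile μ) measurableSet_Iic]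
  have hpre : quantile μ ⁻¹' Set.Iic x = Set.Iic ⟨cdf μ x, ⟨cdf_nonneg μ x, cdf_le_one μ x⟩⟩ := by
    ext u
    rw [Set.mem_preimage, Set.mem_Iic, Set.mem_Iic, quantile_le_iff]
    exact Iff.rfl
  rw [hpre, unitInterval.volume_Iic]
  change μ (Set.Iic x) = ENNReal.ofReal (cdf μ x)
  rw [cdf_coe, measureReal_def, ENNReal.ofReal_toReal (measure_ne_top _ _)]

/-- **The quantile transform is a measure-preserving map `([0,1], λ) → ([0,1], μ)`.** [folklore] -/
theorem measurePreserving_quantile : MeasurePreserving (quantile μ) volume μ :=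
  ⟨measurable_quantile μ, map_quantile_volume μ⟩

end UnitIntervalQuantile

/-! ### `E_n` along measure-preserving maps, for measurable families -/

/-- **`E_n` is invariant under measure-preserving maps, for measurable families** (all joint moments agree by
the change of variables; no injectivity of the map is needed). [cite: LiebSahi2021, Def. 3.1] -/
theorem msahiE_comp_measurePreserving_of_measurable {Ω Ω' : Type*} [MeasurableSpace Ω] [MeasurableSpace Ω']
    {μ : Measure Ω} {ν : Measure Ω'} {φ : Ω' → Ω} (hφ : MeasurePreserving φ ν μ) (n : ℕ)
    (f : Fin n → Ω → ℝ) (hf : ∀ i, Measurable (f i)) :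
    msahiE ν n (fun i => f i ∘ φ) = msahiE μ n f := by
  refine msahiE_congr_of_moments ν μ _ f fun S => ?_
  have h : (∏ i ∈ S, (f i ∘ φ)) = (∏ i ∈ S, f i) ∘ φ := by
    funext x
    simp only [Finset.prod_apply, Function.comp_apply]
  have hm : Measurable (∏ i ∈ S, f i) := by
    have e : (∏ i ∈ S, f i) = fun a => ∏ i ∈ S, f i a := funext fun a => Finset.prod_apply a S f
    rw [e]
    exact Finset.measurable_prod S fun i _ => hf i
  rw [h, ← hφ.map_eq, integral_map hφ.measurable.aemeasurable hm.aestronglyMeasurable]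
  rfl

/-! ### The continuous case controls every monotone image of Lebesgue measure, every product measure -/

variable {d n : ℕ}

/-- **Monotone images of Lebesgue measure**: if `LiebSahiContinuum d n` holds then for every monotone measurable
map `G : Q_d → Ω` into a measurable preorder, the image measure `G_* λ` satisfies `E_n(f_0,…,f_{n−1}) ≥ 0` for all
nonnegative monotone measurable `f_i : Ω → ℝ` (pull the family back along `G`). [this work] -/
theorem msahiE_map_nonneg_of_liebSahiContinuum (h : LiebSahiContinuum d n) {Ω : Type*} [MeasurableSpace Ω]
    [Preorder Ω] {G : (Fin d → I) → Ω} (hGm : Measurable G) (hG : Monotone G) (f : Fin n → Ω → ℝ)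
    (hfm : ∀ i, Measurable (f i)) (hf0 : ∀ i x, 0 ≤ f i x) (hmono : ∀ i, Monotone (f i)) :
    0 ≤ msahiE ((volume : Measure (Fin d → I)).map G) n f := by
  have hmp : MeasurePreserving G volume ((volume : Measure (Fin d → I)).map G) := ⟨hGm, rfl⟩
  rw [← msahiE_comp_measurePreserving_of_measurable hmp n f hfm]
  exact liebSahiContinuum_iff_mSahiPositive.1 h _ (fun i x => hf0 i _) fun i x y hxy => hmono i (hG hxy)

/-- The same for monotone DECREASING families. [this work] -/
theorem msahiE_map_nonneg_of_liebSahiContinuum_antitone (h : LiebSahiContinuum d n) {Ω : Type*}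
    [MeasurableSpace Ω] [Preorder Ω] {G : (Fin d → I) → Ω} (hGm : Measurable G) (hG : Monotone G)
    (f : Fin n → Ω → ℝ) (hfm : ∀ i, Measurable (f i)) (hf0 : ∀ i x, 0 ≤ f i x) (hanti : ∀ i, Antitone (f i)) :
    0 ≤ msahiE ((volume : Measure (Fin d → I)).map G) n f := by
  have hmp : MeasurePreserving G volume ((volume : Measure (Fin d → I)).map G) := ⟨hGm, rfl⟩
  rw [← msahiE_comp_measurePreserving_of_measurable hmp n f hfm]
  exact h _ (fun i x => hf0 i _) fun i x y hxy => hanti i (hG hxy)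

/-- The coordinatewise quantile transform pushes Lebesgue measure on `Q_d` to the product measure `⊗_j μ_j`
(plumbing). [folklore] -/
private theorem measurePreserving_quantilePi (μ : Fin d → Measure I) [∀ j, IsProbabilityMeasure (μ j)] :
    MeasurePreserving (fun (u : Fin d → I) (j : Fin d) => UnitIntervalQuantile.quantile (μ j) (u j))
      (volume : Measure (Fin d → I)) (Measure.pi μ) :=
  measurePreserving_pi (fun _ : Fin d => (volume : Measure I)) μ
    fun j => UnitIntervalQuantile.measurePreserving_quantile (μ j)

/-- **Every product probability measure on `Q_d`**: if `LiebSahiContinuum d n` holds then for arbitrary Borel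
probability measures `μ_0,…,μ_{d−1}` on `[0,1]` (atoms and singular parts allowed) and all nonnegative monotone
increasing measurable `f_i : Q_d → ℝ`, `E_n(f_0,…,f_{n−1}) ≥ 0` under `μ_0 ⊗ ⋯ ⊗ μ_{d−1}` (coordinatewise quantile
transform). [this work] -/
theorem msahiE_pi_nonneg_of_liebSahiContinuum (h : LiebSahiContinuum d n) (μ : Fin d → Measure I)
    [∀ j, IsProbabilityMeasure (μ j)] (f : Fin n → (Fin d → I) → ℝ) (hfm : ∀ i, Measurable (f i))
    (hf0 : ∀ i x, 0 ≤ f i x) (hmono : ∀ i, Monotone (f i)) : 0 ≤ msahiE (Measure.pi μ) n f := by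
  rw [← msahiE_comp_measurePreserving_of_measurable (measurePreserving_quantilePi μ) n f hfm]
  exact liebSahiContinuum_iff_mSahiPositive.1 h _ (fun i x => hf0 i _) fun i x y hxy =>
    hmono i fun j => UnitIntervalQuantile.quantile_mono (μ j) (hxy j)

/-- The same for monotone DECREASING families (Lieb–Sahi's printed form). [this work] -/
theorem msahiE_pi_nonneg_of_liebSahiContinuum_antitone (h : LiebSahiContinuum d n) (μ : Fin d → Measure I)
    [∀ j, IsProbabilityMeasure (μ j)] (f : Fin n → (Fin d → I) → ℝ) (hfm : ∀ i, Measurable (f i))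
    (hf0 : ∀ i x, 0 ≤ f i x) (hanti : ∀ i, Antitone (f i)) : 0 ≤ msahiE (Measure.pi μ) n f := by
  rw [← msahiE_comp_measurePreserving_of_measurable (measurePreserving_quantilePi μ) n f hfm]
  exact h _ (fun i x => hf0 i _) fun i x y hxy => hanti i fun j => UnitIntervalQuantile.quantile_mono (μ j) (hxy j)

/-- **The continuous case is a statement about all product measures**: `LiebSahiContinuum d n` holds iff
`E_n ≥ 0` under EVERY product probability measure on `Q_d` for all nonnegative monotone decreasing measurable
families.  (`⇐`: Lebesgue measure is the product of the uniform marginals, and for Lebesgue measure every monotone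
family may be replaced by an a.e. equal monotone Borel one, `LebesgueCube.mSahiPositive_volume_of_measurable`.)
[this work] -/
theorem liebSahiContinuum_iff_pi :
    LiebSahiContinuum d n ↔
      ∀ (μ : Fin d → Measure I), (∀ j, IsProbabilityMeasure (μ j)) →
        ∀ f : Fin n → (Fin d → I) → ℝ, (∀ i, Measurable (f i)) → (∀ i x, 0 ≤ f i x) →
          (∀ i, Antitone (f i)) → 0 ≤ msahiE (Measure.pi μ) n f := by
  constructor
  · intro h μ hμ f hfm hf0 hanti
    exact msahiE_pi_nonneg_of_liebSahiContinuum_antitone h μ f hfm hf0 hanti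
  · intro h
    -- the measurable increasing form for Lebesgue measure, then remove measurability
    have hvol : (Measure.pi fun _ : Fin d => (volume : Measure I)) = volume := rfl
    have hrefl : MeasurePreserving (fun (x : Fin d → I) (j : Fin d) => unitInterval.symm (x j)) volume volume :=
      volume_preserving_pi fun _ => unitInterval.measurePreserving_symm
    have hmeas : ∀ f : Fin n → (Fin d → I) → ℝ, (∀ i, Measurable (f i)) → (∀ i x, 0 ≤ f i x) →
        (∀ i, Monotone (f i)) → 0 ≤ msahiE (volume : Measure (Fin d → I)) n f := by
      intro f hfm hf0 hmono
      rw [← msahiE_comp_measurePreserving_of_measurable hrefl n f hfm, ← hvol]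
      refine h _ (fun _ => inferInstance) _ (fun i => (hfm i).comp ?_) (fun i x => hf0 i _)
        fun i x y hxy => hmono i fun j => unitInterval.symm_le_symm.2 (hxy j)
      exact measurable_pi_lambda _ fun j => unitInterval.measurable_symm.comp (measurable_pi_apply j)
    exact liebSahiContinuum_iff_mSahiPositive.2 (LebesgueCube.mSahiPositive_volume_of_measurable hmeas)

/-! ### Unconditionally: `d ≤ 2` — every product probability measure on `[0,1]` and on the unit square -/

/-- **Every product probability measure on `Q_d`, `d ≤ 2`, is Sahi-positive of every order for measurable
families** (layers `d ≤ 2` of the continuous case are theorems). [this work] -/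
theorem msahiE_pi_nonneg_of_le_two (hd : d ≤ 2) (μ : Fin d → Measure I) [∀ j, IsProbabilityMeasure (μ j)]
    (n : ℕ) (f : Fin n → (Fin d → I) → ℝ) (hfm : ∀ i, Measurable (f i)) (hf0 : ∀ i x, 0 ≤ f i x)
    (hmono : ∀ i, Monotone (f i)) : 0 ≤ msahiE (Measure.pi μ) n f :=
  msahiE_pi_nonneg_of_liebSahiContinuum (liebSahiContinuum_of_le_two hd n) μ f hfm hf0 hmono

/-- **Every product probability measure `μ_1 ⊗ μ_2` on the unit square is Sahi-positive of every order**
(measurable families, increasing form): for arbitrary Borel probability measures `μ_1, μ_2` on `[0,1]` — atoms and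
singular parts allowed — and nonnegative monotone increasing measurable `f_i : [0,1]² → ℝ`,
`E_n(f_0,…,f_{n−1}) ≥ 0` under `μ_1 ⊗ μ_2`.  Extends Lieb–Sahi's Theorem 3.7 (`μ_i` = Lebesgue) by the quantile
coupling. [this work] -/
theorem msahiE_prod_nonneg_of_monotone (μ₁ μ₂ : Measure I) [IsProbabilityMeasure μ₁] [IsProbabilityMeasure μ₂]
    (n : ℕ) (f : Fin n → I × I → ℝ) (hfm : ∀ i, Measurable (f i)) (hf0 : ∀ i p, 0 ≤ f i p)
    (hmono : ∀ i, Monotone (f i)) : 0 ≤ msahiE (μ₁.prod μ₂) n f := by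
  haveI : ∀ j, IsProbabilityMeasure (![μ₁, μ₂] j) := Fin.forall_fin_two.2 ⟨‹_›, ‹_›⟩
  have he := measurePreserving_finTwoArrow_vec μ₁ μ₂
  rw [← msahiE_comp_measurePreserving he MeasurableEquiv.finTwoArrow.measurableEmbedding n f]
  refine msahiE_pi_nonneg_of_le_two le_rfl ![μ₁, μ₂] n _
    (fun i => (hfm i).comp MeasurableEquiv.finTwoArrow.measurable) (fun i x => hf0 i _) fun i x y hxy => ?_
  exact hmono i ⟨hxy 0, hxy 1⟩

/-- **Every product probability measure on the unit square, printed (decreasing) form**: nonnegative monotone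
decreasing measurable `f_i` have `E_n ≥ 0` under `μ_1 ⊗ μ_2`. [this work] -/
theorem msahiE_prod_nonneg_of_antitone (μ₁ μ₂ : Measure I) [IsProbabilityMeasure μ₁] [IsProbabilityMeasure μ₂]
    (n : ℕ) (f : Fin n → I × I → ℝ) (hfm : ∀ i, Measurable (f i)) (hf0 : ∀ i p, 0 ≤ f i p)
    (hanti : ∀ i, Antitone (f i)) : 0 ≤ msahiE (μ₁.prod μ₂) n f := by
  haveI : ∀ j, IsProbabilityMeasure (![μ₁, μ₂] j) := Fin.forall_fin_two.2 ⟨‹_›, ‹_›⟩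
  have he := measurePreserving_finTwoArrow_vec μ₁ μ₂
  rw [← msahiE_comp_measurePreserving he MeasurableEquiv.finTwoArrow.measurableEmbedding n f]
  refine msahiE_pi_nonneg_of_liebSahiContinuum_antitone (liebSahiContinuum_two n) ![μ₁, μ₂] _
    (fun i => (hfm i).comp MeasurableEquiv.finTwoArrow.measurable) (fun i x => hf0 i _) fun i x y hxy => ?_
  exact hanti i ⟨hxy 0, hxy 1⟩

/-- **Every probability measure on `[0,1]` which is a monotone measurable image of Lebesgue measure on the unit
square** (e.g. every product measure, every pushforward of one along a monotone map) is Sahi-positive of every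
order for measurable families. [this work] -/
theorem msahiE_map_unitSquare_nonneg {Ω : Type*} [MeasurableSpace Ω] [Preorder Ω] {G : (Fin 2 → I) → Ω}
    (hGm : Measurable G) (hG : Monotone G) (n : ℕ) (f : Fin n → Ω → ℝ) (hfm : ∀ i, Measurable (f i))
    (hf0 : ∀ i x, 0 ≤ f i x) (hmono : ∀ i, Monotone (f i)) :
    0 ≤ msahiE ((volume : Measure (Fin 2 → I)).map G) n f :=
  msahiE_map_nonneg_of_liebSahiContinuum (liebSahiContinuum_two n) hGm hG f hfm hf0 hmono

/-! ### Consistency with the unit square `I × I` of `LebesgueSquare.lean` -/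

/-- **Layer `d = 2` is literally Lieb–Sahi's unit square**: `LiebSahiContinuum 2 n` is equivalent to `E_n ≥ 0`
for all nonnegative monotone decreasing families on `I × I` with Lebesgue measure (the form of `liebSahi_thm37`),
along the measurable order isomorphism `(Fin 2 → I) ≃ I × I` (so `liebSahi_thm37` re-proves `liebSahiContinuum_two`,
see the `example` below). [cite: LiebSahi2021, Thm. 3.7] -/
theorem liebSahiContinuum_two_iff_unitSquare (n : ℕ) :
    LiebSahiContinuum 2 n ↔
      ∀ f : Fin n → I × I → ℝ, (∀ i p, 0 ≤ f i p) → (∀ i, Antitone (f i)) →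
        0 ≤ msahiE (volume : Measure (I × I)) n f := by
  have he : MeasurePreserving (MeasurableEquiv.finTwoArrow : (Fin 2 → I) ≃ᵐ I × I) volume volume :=
    volume_preserving_finTwoArrow I
  have hmono : ∀ x y : Fin 2 → I, x ≤ y →
      (MeasurableEquiv.finTwoArrow : (Fin 2 → I) ≃ᵐ I × I) x ≤ MeasurableEquiv.finTwoArrow y :=
    fun x y hxy => ⟨hxy 0, hxy 1⟩
  have hmono' : ∀ p q : I × I, p ≤ q →
      (MeasurableEquiv.finTwoArrow : (Fin 2 → I) ≃ᵐ I × I).symm p ≤ MeasurableEquiv.finTwoArrow.symm q := by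
    intro p q hpq j
    fin_cases j
    · exact hpq.1
    · exact hpq.2
  constructor
  · intro h f hf0 hanti
    rw [← msahiE_comp_measurePreserving he MeasurableEquiv.finTwoArrow.measurableEmbedding n f]
    exact h _ (fun i x => hf0 i _) fun i x y hxy => hanti i (hmono x y hxy)
  · intro h f hf0 hanti
    rw [← msahiE_comp_measurePreserving he.symm MeasurableEquiv.finTwoArrow.symm.measurableEmbedding n f]
    exact h _ (fun i p => hf0 i _) fun i p q hpq => hanti i (hmono' p q hpq)

-- Consistency: `(liebSahiContinuum_two_iff_unitSquare n).2 fun f hf0 hanti => liebSahi_thm37 n f hf0 hanti`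
-- re-proves `liebSahiContinuum_two n` from Theorem 3.7 as printed on `I × I` (not restated: `dedup.landed`).
example (n : ℕ) : LiebSahiContinuum 2 n :=
  (liebSahiContinuum_two_iff_unitSquare n).2 fun f hf0 hanti => liebSahi_thm37 n f hf0 hanti

end Summit.CriticalPhenomena.PercolationContinuityZ3.Theorems
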